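import Summits.CriticalPhenomena.CardyFormulaZ2.Theorems.CardyFlipRussoQuadrupoleSelectionRuleEndpoint
import HarnessLib

/-!
# Flip locality on the bits leg: the crude crossing event only reads the bits of the window

Helper file for the informal kernel crux `QuadrupoleSelectionRule` (stmt-CriticalPhenomena-7029) of
route `CardyFlipRusso` (sub-problem `CardyFormulaZ2`), line `Sketch`, generation 4 (wave 3),
stubs L1 (`crossingEvent_gamma_congr`), L2 (`crossingEvent_gammaMesh_eq`) and L3
(`faceResponse_eq_zero_of_not_mem_faces`).  Vocabulary:
`Theorems/CardyFlipRussoQuadrupoleSelectionRuleDefs.lean` (namespace `…Theorems.BitsLeg`: the leg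
graph `Gamma τ`, its frozen version `GammaMesh R δ τ = Gamma (τ ∩ ↑(faces R δ))`, the crude
crossing event `crossingEvent R δ G` of the window `S = {y | δ · zGs y ∈ Ω}`, the annealed flip
response `faceResponse`), the window lemmas `mem_faces_of_inl_mem` / `mem_faces_of_inr_mem` of
`…Endpoint.lean` and the locality of connection events `siteConnIn_congr` /
`siteConnIn_flipGraph_eq` of `…FlipLocality.lean`.

* L1 `crossingEvent_gamma_congr`: the crude crossing event reads the graph only through the
  adjacency of pairs of vertices of the window (`siteConnIn` is an event of the open subgraph
  induced on `S`).  For `x, y ∈ S` the adjacencies `(Γ τ₁).Adj x y`, `(Γ τ₂).Adj x y` can only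
  differ through a `ℤ²`-diagonal `s(x, y) = s(B k, D k)` (then `B k ∈ {x, y} ⊆ S`) or a dual
  diagonal `s(x, y) = s(A k, C k)` (then `A k ∈ {x, y} ⊆ S`); so two bit configurations that
  agree at every face whose pivot `B k` or dual corner `A k` is read in the window give the same
  event (transport the SAME witness `k` through the existential of `gamma_adj`).
* L2 `crossingEvent_gammaMesh_eq`: freezing the bits outside the box `faces R δ` changes nothing,
  since a face with `B k ∈ S` (resp. `A k ∈ S`) lies in the box (`mem_faces_of_inl_mem`,
  `mem_faces_of_inr_mem`, `δ > 0`).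
* L3 `faceResponse_eq_zero_of_not_mem_faces`: a face outside the box has both diagonals with an
  endpoint (`A k`, resp. `B k`) outside the window, so its flip changes no connection event in
  the window (`siteConnIn_flipGraph_eq`), the crude crossing event does not see the flip, every
  integrand `flipResponse … (crossingEvent R δ) half` vanishes
  (`flipResponse_eq_zero_of_apply_flipGraph_eq`) and so does its `legLaw t`-average.
-/

noncomputable section

open MeasureTheory Set

namespace Summit.CriticalPhenomena.CardyFormulaZ2.Theorems.BitsLeg

open Literature.Probability.LatticeModels Literature.Probability.Percolation
  Literature.Probability.RandomPlanarGeometry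
open Summit.CriticalPhenomena.CardyFormulaZ2.Cruxes.SquareFromVoronoiHub.VoronoiBlocks (zGs)

/-! ### L1: bit configurations agreeing on the window give the same crossing event -/

/-- Inside the window `S = {y | δ · zGs y ∈ Ω}`, two bit configurations that agree at every face
whose pivot `B k` or dual corner `A k` is read in `S` give the same edges of `Γ`. [folklore] -/
theorem gamma_adj_congr_of_mem (R : ConformalRectangle) (δ : ℝ) {τ₁ τ₂ : Set Face}
    (hB : ∀ k : Face, (δ : ℂ) * zGs (fB k) ∈ R.carrier → (k ∈ τ₁ ↔ k ∈ τ₂))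
    (hA : ∀ k : Face, (δ : ℂ) * zGs (fA k) ∈ R.carrier → (k ∈ τ₁ ↔ k ∈ τ₂)) {x y : V}
    (hx : (δ : ℂ) * zGs x ∈ R.carrier) (hy : (δ : ℂ) * zGs y ∈ R.carrier) :
    (Gamma τ₁).Adj x y ↔ (Gamma τ₂).Adj x y := by
  rw [gamma_adj, gamma_adj]
  refine and_congr_right fun _ => or_congr_right (or_congr_right (exists_congr fun k => ?_))
  refine or_congr (and_congr_left fun h => hB k ?_) (and_congr_left fun h => not_congr (hA k ?_))
  · rcases Sym2.eq_iff.1 h with ⟨h1, -⟩ | ⟨-, h2⟩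
    · rw [h1] at hx; exact hx
    · rw [h2] at hy; exact hy
  · rcases Sym2.eq_iff.1 h with ⟨h1, -⟩ | ⟨-, h2⟩
    · rw [h1] at hx; exact hx
    · rw [h2] at hy; exact hy

/-- **L1 (flip locality of the crude crossing event).** Two bit configurations that agree at
every face whose pivot corner `B k` or dual corner `A k` is read in the window
`{y | δ · zGs y ∈ Ω}` have the same crude crossing event: connection events in the window only
read the edges with both endpoints inside it. [folklore] -/
theorem crossingEvent_gamma_congr :
    ∀ (R : Literature.Probability.RandomPlanarGeometry.ConformalRectangle) (δ : ℝ)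
      (τ₁ τ₂ : Set Summit.CriticalPhenomena.CardyFormulaZ2.Theorems.BitsLeg.Face),
      (∀ k : Summit.CriticalPhenomena.CardyFormulaZ2.Theorems.BitsLeg.Face,
        (δ : ℂ) * Summit.CriticalPhenomena.CardyFormulaZ2.Cruxes.SquareFromVoronoiHub.VoronoiBlocks.zGs
          (Summit.CriticalPhenomena.CardyFormulaZ2.Theorems.BitsLeg.fB k) ∈ R.carrier →
          (k ∈ τ₁ ↔ k ∈ τ₂)) →
      (∀ k : Summit.CriticalPhenomena.CardyFormulaZ2.Theorems.BitsLeg.Face,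
        (δ : ℂ) * Summit.CriticalPhenomena.CardyFormulaZ2.Cruxes.SquareFromVoronoiHub.VoronoiBlocks.zGs
          (Summit.CriticalPhenomena.CardyFormulaZ2.Theorems.BitsLeg.fA k) ∈ R.carrier →
          (k ∈ τ₁ ↔ k ∈ τ₂)) →
      Summit.CriticalPhenomena.CardyFormulaZ2.Theorems.BitsLeg.crossingEvent R δ
          (Summit.CriticalPhenomena.CardyFormulaZ2.Theorems.BitsLeg.Gamma τ₁) =
        Summit.CriticalPhenomena.CardyFormulaZ2.Theorems.BitsLeg.crossingEvent R δ
          (Summit.CriticalPhenomena.CardyFormulaZ2.Theorems.BitsLeg.Gamma τ₂) := by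
  intro R δ τ₁ τ₂ hB hA
  have hconn : ∀ u v : V,
      siteConnIn (Gamma τ₁) {y : V | (δ : ℂ) * zGs y ∈ R.carrier} u v =
        siteConnIn (Gamma τ₂) {y : V | (δ : ℂ) * zGs y ∈ R.carrier} u v := fun u v =>
    siteConnIn_congr (fun _ _ hx hy => gamma_adj_congr_of_mem R δ hB hA hx hy) u v
  ext ω
  simp only [crossingEvent, Set.mem_setOf_eq, hconn]

/-! ### L2: freezing the bits outside the box changes nothing -/

/-- **L2.** The crude crossing event read in the frozen graph `Γ^δ τ = Γ (τ ∩ faces R δ)` is the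
one read in `Γ τ`: a face one of whose diagonals has its pivot-side endpoint in the window lies
in the box `faces R δ`. [folklore] -/
theorem crossingEvent_gammaMesh_eq :
    ∀ (R : Literature.Probability.RandomPlanarGeometry.ConformalRectangle) (δ : ℝ)
      (τ : Set Summit.CriticalPhenomena.CardyFormulaZ2.Theorems.BitsLeg.Face), 0 < δ →
      Summit.CriticalPhenomena.CardyFormulaZ2.Theorems.BitsLeg.crossingEvent R δ
          (Summit.CriticalPhenomena.CardyFormulaZ2.Theorems.BitsLeg.GammaMesh R δ τ) =
        Summit.CriticalPhenomena.CardyFormulaZ2.Theorems.BitsLeg.crossingEvent R δ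
          (Summit.CriticalPhenomena.CardyFormulaZ2.Theorems.BitsLeg.Gamma τ) := by
  intro R δ τ hδ
  refine crossingEvent_gamma_congr R δ (τ ∩ ↑(faces R δ)) τ (fun k hk => ?_) (fun k hk => ?_)
  · exact ⟨fun h => h.1, fun h => ⟨h, Finset.mem_coe.2 (mem_faces_of_inl_mem R hδ hk)⟩⟩
  · exact ⟨fun h => h.1, fun h => ⟨h, Finset.mem_coe.2 (mem_faces_of_inr_mem R hδ hk)⟩⟩

/-! ### L3: faces outside the box do not respond -/

/-- The flip at a face outside the box does not change the crude crossing event of any graph: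
both its diagonals have an endpoint (`A k`, resp. `B k`) outside the window. [folklore] -/
theorem crossingEvent_flipGraph_eq_of_not_mem_faces (R : ConformalRectangle) {δ : ℝ} (hδ : 0 < δ)
    {k : Face} (hk : k ∉ faces R δ) (G : SimpleGraph V) :
    crossingEvent R δ (flipGraph G (fA k) (fB k) (fC k) (fD k)) = crossingEvent R δ G := by
  have hA : fA k ∉ {y : V | (δ : ℂ) * zGs y ∈ R.carrier} := fun h =>
    hk (mem_faces_of_inr_mem R hδ h)
  have hB : fB k ∉ {y : V | (δ : ℂ) * zGs y ∈ R.carrier} := fun h =>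
    hk (mem_faces_of_inl_mem R hδ h)
  ext ω
  simp only [crossingEvent, Set.mem_setOf_eq, siteConnIn_flipGraph_eq G (Or.inl hA) (Or.inl hB)]

/-- **L3.** A face outside the box `faces R δ` has zero annealed flip response: its flip changes
no connection event in the window, so every integrand vanishes. [folklore] -/
theorem faceResponse_eq_zero_of_not_mem_faces :
    ∀ (R : Literature.Probability.RandomPlanarGeometry.ConformalRectangle) (t δ : ℝ)
      (k : Summit.CriticalPhenomena.CardyFormulaZ2.Theorems.BitsLeg.Face), 0 < δ →
      k ∉ Summit.CriticalPhenomena.CardyFormulaZ2.Theorems.BitsLeg.faces R δ →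
      Summit.CriticalPhenomena.CardyFormulaZ2.Theorems.BitsLeg.faceResponse R t δ k = 0 := by
  intro R t δ k hδ hk
  have h0 : ∀ τ : Set Face, flipResponse (GammaMesh R δ (τ \ {k})) (fA k) (fB k) (fC k) (fD k)
      (crossingEvent R δ) half = 0 := fun τ =>
    flipResponse_eq_zero_of_apply_flipGraph_eq
      (crossingEvent_flipGraph_eq_of_not_mem_faces R hδ hk _) half
  simp only [faceResponse, h0, integral_zero]

end Summit.CriticalPhenomena.CardyFormulaZ2.Theorems.BitsLeg

end
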